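import Summits.BirchSwinnertonDyer.BirchSwinnertonDyer.Theses.EisensteinPrimes
import Summits.BirchSwinnertonDyer.BirchSwinnertonDyer.Theorems.EisensteinPrimesMazurMCOnCellBTwistbackLowerHalf
import Summits.BirchSwinnertonDyer.Rank1Residual.X2.RankOneNonsplitCertificate
import Summits.BirchSwinnertonDyer.Rank1Residual.X2.RankOneSplitResidueExact
import Summits.BirchSwinnertonDyer.Rank1Residual.X2.RankOneNonsplitTransfer
import HarnessLib

/-!
# Crux 3 `MazurMCOnCellB` (stmt-BirchSwinnertonDyer-19033), line `twistback`: what delivers the UPPER half of `BSD(p)` at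
# ONE partner, PER PARTNER — and the per-pair headline: Mazur's MC at a NON-SPLIT X2b pair from STEP L at one Heegner
# datum and the analytic certificate `ord_{T=0} L_p(E^K, T) = 1` at ONE admissible twist (no height, no Schneider hypothesis)

LEAD bsd-line-x2-p1 g9 (2026-08-28); companion of `…TwistbackOnePartner.lean` (the class-level ∃-PARTNER compositions).
HONEST FRAMING (cell `bsd-eis`, run/shared/lean/pub/bsd-eis/): conditional theorems only; nothing booked; X2 stays
CONSTRUCTION-SHAPED; no label or count moves; Mazur's main conjecture / BSD is proved for NO curve here; no summit
statement is proved. Inputs BY NAME: the route's `PublishedInputs` (item 19037) and Disegni 2020 Thm. 4(1) (PUBLISHED);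
per pair / per partner: finite statements about THE Mazur–Tate–Teitelbaum `p`-adic `L`-function of the partner
(`ord_{T=0} L = 1`, or the two-engine `(μ_an, λ_an)` certificate `X2.AnalyticMuLE` / `X2.AnalyticLambdaEq`), STEP L over
`K` at one Heegner datum (`X11b.IndexLowerBoundAt`; = item -27489 there, a theorem modulo Keller–Yin Thm. D + PUB), and
at a SPLIT partner the typed exceptional leading term `X2.O9.ExceptionalLeadingTermAt` (OPEN for reducible `E[p]`).

* §3 — the partner `(V, ℓ)` is an X2c ∩ `GVPar` pair, so Mazur's MC there is Greenberg–Vatsal's; its upper half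
  `Typed.MissingUpperBoundAt V ℓ` follows (i) at a NON-split `ℓ` from `ord_{T=0} L_ℓ(V,T) = 1` ALONE (b2b gen 19
  `X2.bsdp_of_cellC_of_not_split_of_mazurMainConjectureAt_of_orderOne`: Stein–Wuthrich Thm. 6.1 turns `ord = rank` into
  Schneider's non-degeneracy, Disegni 2020 Thm. 4(1) gives the leading term), (ii) at a NON-split `ℓ` from
  `(μ_an, λ_an) = (0, 1)` (`X2.bsdp_of_cellC_of_not_split_of_lamMin`, not even Greenberg–Vatsal), (iii) at a SPLIT `ℓ`
  from `(μ_an, λ_an) = (0, 2)` + the typed exceptional leading term (`X2.exceptionalLeadingTermAt_iff_bsdp_of_lamMin_split`).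
* §4 — PER PAIR, NON-SPLIT: `X2.MazurMainConjectureAt W p` at an X2b pair from STEP L (rank-zero orientation) at ONE
  Heegner datum with `p ∤ c` and `ord_{T=0} L_p = 1` for ONE admissible twist (p625263 §2 + §3 (i); the twist keeps the
  non-split type because `p` splits in `K`).

What this is NOT: not a proof of Schneider's conjecture at any pair, of any main conjecture or of BSD for any curve;
0 cells / labels / tiers move. References: [Disegni2020] Thm. 4 (§3.2); [SteinWuthrich2013] Thm. 6.1, §4.2;
[GreenbergVatsal2000] Thm. (1.3), pp. 14–15, p. 4; [Wuthrich2014] Thm. 16; [JetchevSkinnerWan2017] §7.4.1;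
[MazurTateTeitelbaum1986Invent] §II.10; [Miller2011LMS] Def. 1.1.
-/

set_option autoImplicit false

-- `Summit.BirchSwinnertonDyer.BirchSwinnertonDyer.…`: the summit and its single sub-problem share a name.
set_option linter.dupNamespace false

noncomputable section

open scoped Classical MatrixGroups ModularForm

open CongruenceSubgroup WeierstrassCurve NumberField
  Literature.NumberTheory.EllipticCurves
  Literature.NumberTheory.EllipticCurves.ModularForms
  Literature.NumberTheory.QuadraticFields
  Literature.NumberTheory.EllipticCurves.KrizLi2019
  Literature.NumberTheory.EllipticCurves.Rank1Residual
  Literature.NumberTheory.EllipticCurves.Rank1Residual.Typed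
  Literature.NumberTheory.EllipticCurves.Wuthrich2014
  Literature.NumberTheory.EllipticCurves.SteinWuthrich2013
  Literature.NumberTheory.EllipticCurves.GreenbergVatsal2000
  Literature.NumberTheory.EllipticCurves.Disegni2020
  Summit.BirchSwinnertonDyer.Rank1Residual
  Summit.BirchSwinnertonDyer.BirchSwinnertonDyer.Theses
  Summit.BirchSwinnertonDyer.BirchSwinnertonDyer.Theorems.Rank1ResidualX1RankZeroTwist
  Summit.BirchSwinnertonDyer.BirchSwinnertonDyer.Theorems.EisensteinPrimesMazurMCOnCellBTwistbackLowerHalf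

namespace Summit.BirchSwinnertonDyer.BirchSwinnertonDyer.Theorems.EisensteinPrimesMazurMCOnCellBTwistbackOnePartnerCertificates

/-! ## §3. What delivers the partner's upper half, PER PARTNER (the partner is an X2c ∩ `GVPar` pair) -/

/-- **NON-SPLIT partner: the analytic certificate `ord_{T=0} L_p = 1` alone gives the upper half** — at an X2c ∩
`GVPar` pair `(V, ℓ)` with `ℓ` NON-split, Mazur's MC is Greenberg–Vatsal's (`X2.mazurMainConjectureAt_of_gvPar`, flag
`GV00-mult-asserted`, + Wuthrich Thm. 16), and b2b gen 19's `X2.bsdp_of_cellC_of_not_split_of_mazurMainConjectureAt_of_orderOne`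
turns `ord_{T=0} L = 1` for THE non-split Mazur–Tate–Teitelbaum function into `BSD(V,ℓ)` (Stein–Wuthrich Thm. 6.1:
`ord = rank` iff the §4.2 height is non-degenerate; Disegni 2020 Thm. 4(1) for the leading term); then the upper half
(`Typed.missingPPartAt_of_bsdp`). NO height is computed and NO Schneider hypothesis is taken: the per-partner input is a
statement about a `p`-adic `L`-FUNCTION. [cite: Disegni2020, Thm. 4 (§3.2)] [cite: SteinWuthrich2013, Thm. 6.1 (p. 20), §4.2]
[cite: GreenbergVatsal2000, Thm. (1.3) with pp. 14–15] [cite: Wuthrich2014, Thm. 16 (p. 397)] -/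
theorem missingUpperBoundAt_of_cellC_of_not_split_of_gvPar_of_orderOne (hP : EisensteinPrimes.PublishedInputs)
    (hDis : padicBSD_rankOne_nonsplitMult)
    (V : WeierstrassCurve ℚ) [V.IsElliptic] [V.IsGloballyMinimal] (ℓ : ℕ) [Fact ℓ.Prime]
    (hcV : X2.CellC V ℓ) (hns : ¬ V.HasSplitMultiplicativeReductionAtPrime ℓ) (hgv : GVPar V ℓ)
    (hordL : ∀ {N : ℕ} [NeZero N] (f : CuspForm (Gamma0 N) 2), IsNewformOf V f →
      ∀ (ϖ : ℚ), (ϖ : ℝ) * V.realPeriodRat = plusPeriod f →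
      ∀ L : PowerSeries ℚ_[ℓ], IsMultPAdicLFunctionOf f ℓ (-1) L → L.order = ((1 : ℕ) : ℕ∞)) :
    MissingUpperBoundAt V ℓ := by
  have hpar := hP.2.2.2.2.1
  have hGZ := hP.2.2.2.2.2.2.2.1
  have hGZK := hP.2.2.2.2.2.2.2.2.2.2.1
  have hGV := hP.2.2.2.2.2.2.2.2.2.2.2.2.2.1
  have hWu := hP.2.2.2.2.2.2.2.2.2.2.2.2.2.2.1
  have hJn := hP.2.2.2.2.2.2.2.2.2.2.2.2.2.2.2.2.1
  have hHn := hP.2.2.2.2.2.2.2.2.2.2.2.2.2.2.2.2.2.2.1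
  have hMC : X2.MazurMainConjectureAt V ℓ :=
    X2.mazurMainConjectureAt_of_gvPar hGV hWu V ℓ hcV.2.1 hcV.2.2.2 hgv
  have hB : BSDp V ℓ :=
    X2.bsdp_of_cellC_of_not_split_of_mazurMainConjectureAt_of_orderOne V ℓ hDis hJn hHn hGZ hGZK hpar hcV
      hns hMC hordL
  haveI : Finite V.sha := (hGZK V (le_of_eq hcV.1)).2
  exact (lower_and_upper_of_missingPPartAt V ℓ (missingPPartAt_of_bsdp V ℓ hB)).2

/-- **NON-SPLIT partner, two-engine form: `(μ_an, λ_an) = (0, 1)` gives the upper half** — b2b gen 19's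
`X2.bsdp_of_cellC_of_not_split_of_lamMin` (Kato–Wuthrich divisibility + the λ-squeeze give BOTH Mazur's MC at the pair
AND Schneider's non-degeneracy; Disegni 2020 / Stein–Wuthrich the two leading terms): no Greenberg–Vatsal input, no
regulator, no congruent relative. [cite: Disegni2020, Thm. 4 (§3.2)] [cite: SteinWuthrich2013, Thm. 6.1 (p. 20), §4.2]
[cite: Wuthrich2014, Thm. 16 (p. 397)] [cite: GreenbergVatsal2000, p. 4 (λ-invariants)] -/
theorem missingUpperBoundAt_of_cellC_of_not_split_of_lamMin (hP : EisensteinPrimes.PublishedInputs)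
    (hDis : padicBSD_rankOne_nonsplitMult)
    (V : WeierstrassCurve ℚ) [V.IsElliptic] [V.IsGloballyMinimal] (ℓ : ℕ) [Fact ℓ.Prime]
    (hcV : X2.CellC V ℓ) (hns : ¬ V.HasSplitMultiplicativeReductionAtPrime ℓ)
    (hμ0 : X2.AnalyticMuLE V ℓ 0) (hlam : X2.AnalyticLambdaEq V ℓ 1) :
    MissingUpperBoundAt V ℓ := by
  have hpar := hP.2.2.2.2.1
  have hGZ := hP.2.2.2.2.2.2.2.1
  have hGZK := hP.2.2.2.2.2.2.2.2.2.2.1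
  have hWu := hP.2.2.2.2.2.2.2.2.2.2.2.2.2.2.1
  have hJs := hP.2.2.2.2.2.2.2.2.2.2.2.2.2.2.2.1
  have hJn := hP.2.2.2.2.2.2.2.2.2.2.2.2.2.2.2.2.1
  have hHs := hP.2.2.2.2.2.2.2.2.2.2.2.2.2.2.2.2.2.1
  have hHn := hP.2.2.2.2.2.2.2.2.2.2.2.2.2.2.2.2.2.2.1
  have hB : BSDp V ℓ :=
    X2.bsdp_of_cellC_of_not_split_of_lamMin V ℓ hDis hWu hJs hJn hHs hHn hGZ hGZK hpar hcV hns hμ0 hlam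
  haveI : Finite V.sha := (hGZK V (le_of_eq hcV.1)).2
  exact (lower_and_upper_of_missingPPartAt V ℓ (missingPPartAt_of_bsdp V ℓ hB)).2

/-- **SPLIT partner: `(μ_an, λ_an) = (0, 2)` + the typed exceptional leading term give the upper half** — b2b's
`X2.exceptionalLeadingTermAt_iff_bsdp_of_lamMin_split` (λ-minimality gives Mazur's MC AND Schneider; under them the
typed `X2.O9.ExceptionalLeadingTermAt` is EQUIVALENT to `BSD(V,ℓ)`). The exceptional leading term for reducible `V[ℓ]`
is OPEN in print (MTT 1986 §II.10; Disegni Thm. 4(2) needs irreducibility via Venerucci 2016).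
[cite: MazurTateTeitelbaum1986Invent, §II.10 (hypothesis)] [cite: SteinWuthrich2013, Thm. 6.1 (p. 20), §4.2]
[cite: Wuthrich2014, Thm. 16 (p. 397)] -/
theorem missingUpperBoundAt_of_cellC_of_split_of_lamMin_of_exceptionalLeadingTerm
    (hP : EisensteinPrimes.PublishedInputs)
    (V : WeierstrassCurve ℚ) [V.IsElliptic] [V.IsGloballyMinimal] (ℓ : ℕ) [Fact ℓ.Prime]
    (hcV : X2.CellC V ℓ) (hsplit : V.HasSplitMultiplicativeReductionAtPrime ℓ)
    (hμ0 : X2.AnalyticMuLE V ℓ 0) (hlam : X2.AnalyticLambdaEq V ℓ 2) (hExc : X2.O9.ExceptionalLeadingTermAt V ℓ) :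
    MissingUpperBoundAt V ℓ := by
  have hpar := hP.2.2.2.2.1
  have hGZ := hP.2.2.2.2.2.2.2.1
  have hGZK := hP.2.2.2.2.2.2.2.2.2.2.1
  have hWu := hP.2.2.2.2.2.2.2.2.2.2.2.2.2.2.1
  have hJs := hP.2.2.2.2.2.2.2.2.2.2.2.2.2.2.2.1
  have hJn := hP.2.2.2.2.2.2.2.2.2.2.2.2.2.2.2.2.1
  have hHs := hP.2.2.2.2.2.2.2.2.2.2.2.2.2.2.2.2.2.1
  have hHn := hP.2.2.2.2.2.2.2.2.2.2.2.2.2.2.2.2.2.2.1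
  have hB : BSDp V ℓ :=
    (X2.exceptionalLeadingTermAt_iff_bsdp_of_lamMin_split V ℓ hWu hJs hJn hHs hHn hGZ hGZK hpar hcV hsplit hμ0
      hlam).mp hExc
  haveI : Finite V.sha := (hGZK V (le_of_eq hcV.1)).2
  exact (lower_and_upper_of_missingPPartAt V ℓ (missingPPartAt_of_bsdp V ℓ hB)).2

/-! ## §4. PER PAIR, non-split: Mazur's MC from STEP L at one Heegner datum and `ord_{T=0} L_p(E^K, T) = 1` at ONE twist -/

/-- **PER PAIR, NON-SPLIT: Mazur's main conjecture at an X2b pair from STEP L over `K` (rank-zero orientation) at ONE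
Heegner datum with `p ∤ c`, and the single analytic certificate `ord_{T=0} L_p = 1` for THE non-split
Mazur–Tate–Teitelbaum function of ONE admissible twist.** Data: `W/ℚ` globally minimal with `X2.CellB W p` (so
`ord_{s=1} L(E,s) = 0`, `p ≠ 2` multiplicative, `E[p]` reducible of the non-GV parity) and `p` NON-split; `K` admissible
(`d_K` odd `< −4`, Heegner for `N` and `p`), `Dt` with `p ∤ c(Dt)`, the Heegner point `P`, a globally minimal model `Wd`
of `E^{(d_K)}` with `ord_{s=1} L = 1`. Then `Wd` is an X2c ∩ `GVPar` pair (`X2.classX2_twist`,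
`gvPar_of_not_gvPar_of_twist`), NON-split at `p` (`p` split in `K`: `X2.hasSplitMultiplicativeReductionAtPrime_iff_of_smul_eq_quadraticTwist`),
so §3 gives its upper half from `hordL`, and p625263 §2 concludes. Inputs by name: `PublishedInputs`, Disegni 2020
Thm. 4(1); per pair: STEP L (`hlow`; = item -27489 at this datum) and `hordL`. No height, no Schneider hypothesis, no
class-wide input. BSD / MC proved for no curve unconditionally. [cite: JetchevSkinnerWan2017, §7.4.1 (eq:shalowerK-1)]
[cite: Disegni2020, Thm. 4 (§3.2)] [cite: SteinWuthrich2013, Thm. 6.1 (p. 20), §4.2]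
[cite: GreenbergVatsal2000, Thm. (1.3) with pp. 14–15] [cite: Wuthrich2014, Thm. 16 (p. 397)] -/
theorem mazurMainConjectureAt_of_cellB_of_not_split_of_indexLowerBoundAt_of_orderOne_twist
    (hP : EisensteinPrimes.PublishedInputs) (hDis : padicBSD_rankOne_nonsplitMult)
    (W : WeierstrassCurve ℚ) [W.IsElliptic] [W.IsGloballyMinimal] (p : ℕ) [Fact p.Prime]
    (hc : X2.CellB W p) (hns : ¬ W.HasSplitMultiplicativeReductionAtPrime p)
    (N : ℕ) [NeZero N] (K : Type) [Field K] [NumberField K]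
    (Dt : ModularParametrizationData W N) (H : HeegnerDatum N (NumberField.discr K)) (ι : K →+* ℂ)
    (P : (W.baseChange K).toAffine.Point)
    (hK : IsImaginaryQuadratic K) (hodd : Odd (NumberField.discr K)) (hlt : NumberField.discr K < -4)
    (hN : W.conductorNorm ℤ = N) (hHN : SatisfiesHeegnerHypothesis N K)
    (hHp : SatisfiesHeegnerHypothesis p K)
    (hPt : WeierstrassCurve.Affine.Point.map ι.toRatAlgHom P = heegnerPointComplex Dt H)
    (hcM : ¬ (p : ℤ) ∣ Dt.c)
    (Wd : WeierstrassCurve ℚ) [Wd.IsElliptic] [Wd.IsGloballyMinimal]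
    (hWd : ∃ C : VariableChange ℚ, C • Wd = W.quadraticTwist (NumberField.discr K : ℚ))
    (hrd : Wd.analyticRank = 1)
    (hlow : Finite (W.baseChange K).sha → X11b.IndexLowerBoundAt W p K P)
    (hordL : ∀ {M : ℕ} [NeZero M] (f : CuspForm (Gamma0 M) 2), IsNewformOf Wd f →
      ∀ (ϖ : ℚ), (ϖ : ℝ) * Wd.realPeriodRat = plusPeriod f →
      ∀ L : PowerSeries ℚ_[p], IsMultPAdicLFunctionOf f p (-1) L → L.order = ((1 : ℕ) : ℕ∞)) :
    X2.MazurMainConjectureAt W p := by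
  have hnf := hP.2.2.2.2.2.1
  have hGZ := hP.2.2.2.2.2.2.2.2.1
  have hKo := hP.2.2.2.2.2.2.2.2.2.1
  have hGZK := hP.2.2.2.2.2.2.2.2.2.2.1
  have hWu := hP.2.2.2.2.2.2.2.2.2.2.2.2.2.2.1
  have hJs := hP.2.2.2.2.2.2.2.2.2.2.2.2.2.2.2.1
  have hJn := hP.2.2.2.2.2.2.2.2.2.2.2.2.2.2.2.2.1
  have hHs := hP.2.2.2.2.2.2.2.2.2.2.2.2.2.2.2.2.2.1
  have hHn := hP.2.2.2.2.2.2.2.2.2.2.2.2.2.2.2.2.2.2.1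
  have hGS := hP.2.2.2.2.2.2.2.2.2.2.2.2.2.2.2.2.2.2.2
  have hE : WeierstrassCurve.hasEntireLFunction_rat :=
    WeierstrassCurve.hasEntireLFunction_rat_of_exists_isNewformOf hnf
  have hpP : p.Prime := Fact.out
  have hp2 : p ≠ 2 := hc.2.1.1
  have hred : ¬ W.HasIrreducibleModPGaloisRep p := hc.2.1.2.1
  have hmult : W.HasMultiplicativeReductionAtPrime p := hc.2.1.2.2
  have hr : W.analyticRank = 0 := hc.1
  obtain ⟨C, hC⟩ := hWd
  have hneg : NumberField.discr K < 0 := IsImaginaryQuadratic.discr_neg hK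
  have hpd : ¬ (p : ℤ) ∣ NumberField.discr K := not_dvd_discr_of_split hK hpP hp2 hHp
  have hXd : ClassX2 Wd p := X2.classX2_twist W p hc.2.1 K hK hHp Wd ⟨C, hC⟩
  have hgv : GVPar Wd p :=
    gvPar_of_not_gvPar_of_twist (W := W) (p := p) hp2 hred hc.2.2 hneg hpd Wd C (by simpa using hC)
  have hnsd : ¬ Wd.HasSplitMultiplicativeReductionAtPrime p := fun hs ↦
    hns ((X2.hasSplitMultiplicativeReductionAtPrime_iff_of_smul_eq_quadraticTwist W Wd hK p hp2 hmult hHp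
      hC).mp hs)
  have hUd : MissingUpperBoundAt Wd p :=
    missingUpperBoundAt_of_cellC_of_not_split_of_gvPar_of_orderOne hP hDis Wd p ⟨hrd, hXd⟩ hnsd hgv hordL
  exact mazurMainConjectureAt_of_indexLowerBoundAt_of_upper_twist hWu hJs hJn hHs hHn hGZK hE W p (hGS W p) N K
    Dt H ι P (hGZ _ W K) (hKo _ W K) hK hodd hlt hN hHN hHp hPt hcM hp2 hmult hred hr Wd ⟨C, hC⟩ hrd hlow hUd

/-! ## §5. (appended, LEAD g9) PER PAIR, non-split: the two-engine form — `(μ_an, λ_an)(E^K) = (0, 1)` at ONE twist -/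

/-- **PER PAIR, NON-SPLIT, two-engine form: Mazur's main conjecture at an X2b pair from STEP L over `K` at ONE Heegner
datum with `p ∤ c` and the census certificate `(μ_an, λ_an) = (0, 1)` for ONE admissible twist** — §4 with the analytic
input of the partner read off the two Iwasawa-invariant engines (`X2.AnalyticMuLE Wd p 0`, `X2.AnalyticLambdaEq Wd p 1`)
instead of `ord_{T=0} L_p = 1`: the twist `Wd` is an X2c ∩ `GVPar` pair NON-split at `p` (`p` splits in `K`), so b2b gen 19's
`X2.bsdp_of_cellC_of_not_split_of_lamMin` (Kato–Wuthrich + λ-squeeze ⟹ MC and Schneider; Disegni / Stein–Wuthrich the leading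
terms) gives `BSD(Wd, p)`, hence its upper half (§3), and p625263 §2 concludes. WHY THIS FORM (LEAD g9 evidence
`Cruxes/MazurMCOnCellB/Lines/twistback-lambda-formula-validation-g9.md`, 51/51 on the census): at a non-split partner
Greenberg–Vatsal's formula reads `λ_an(E^K) = 2·λ_p(ℚ(√(D·d_K))) + c(E)` with `c(E)` a `K`-independent count of split
multiplicative primes, so on the sub-row `c(E) = 1` this hypothesis holds at every admissible `K` with `p ∤ h(ℚ(√(D·d_K)))`
(planning statement, NOT proved here). Inputs by name: `PublishedInputs`, Disegni 2020 Thm. 4(1); per pair: STEP L (`hlow`),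
`hμ0`, `hlam`. No height, no Schneider hypothesis. BSD / MC proved for no curve unconditionally.
[cite: GreenbergVatsal2000, p. 4 (λ-invariants) and Thm. (1.3)] [cite: Disegni2020, Thm. 4 (§3.2)]
[cite: SteinWuthrich2013, Thm. 6.1 (p. 20), §4.2] [cite: Wuthrich2014, Thm. 16 (p. 397)] [cite: JetchevSkinnerWan2017, §7.4.1] -/
theorem mazurMainConjectureAt_of_cellB_of_not_split_of_indexLowerBoundAt_of_lamMin_twist
    (hP : EisensteinPrimes.PublishedInputs) (hDis : padicBSD_rankOne_nonsplitMult)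
    (W : WeierstrassCurve ℚ) [W.IsElliptic] [W.IsGloballyMinimal] (p : ℕ) [Fact p.Prime]
    (hc : X2.CellB W p) (hns : ¬ W.HasSplitMultiplicativeReductionAtPrime p)
    (N : ℕ) [NeZero N] (K : Type) [Field K] [NumberField K]
    (Dt : ModularParametrizationData W N) (H : HeegnerDatum N (NumberField.discr K)) (ι : K →+* ℂ)
    (P : (W.baseChange K).toAffine.Point)
    (hK : IsImaginaryQuadratic K) (hodd : Odd (NumberField.discr K)) (hlt : NumberField.discr K < -4)
    (hN : W.conductorNorm ℤ = N) (hHN : SatisfiesHeegnerHypothesis N K)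
    (hHp : SatisfiesHeegnerHypothesis p K)
    (hPt : WeierstrassCurve.Affine.Point.map ι.toRatAlgHom P = heegnerPointComplex Dt H)
    (hcM : ¬ (p : ℤ) ∣ Dt.c)
    (Wd : WeierstrassCurve ℚ) [Wd.IsElliptic] [Wd.IsGloballyMinimal]
    (hWd : ∃ C : VariableChange ℚ, C • Wd = W.quadraticTwist (NumberField.discr K : ℚ))
    (hrd : Wd.analyticRank = 1)
    (hlow : Finite (W.baseChange K).sha → X11b.IndexLowerBoundAt W p K P)
    (hμ0 : X2.AnalyticMuLE Wd p 0) (hlam : X2.AnalyticLambdaEq Wd p 1) :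
    X2.MazurMainConjectureAt W p := by
  have hnf := hP.2.2.2.2.2.1
  have hGZ := hP.2.2.2.2.2.2.2.2.1
  have hKo := hP.2.2.2.2.2.2.2.2.2.1
  have hGZK := hP.2.2.2.2.2.2.2.2.2.2.1
  have hWu := hP.2.2.2.2.2.2.2.2.2.2.2.2.2.2.1
  have hJs := hP.2.2.2.2.2.2.2.2.2.2.2.2.2.2.2.1
  have hJn := hP.2.2.2.2.2.2.2.2.2.2.2.2.2.2.2.2.1
  have hHs := hP.2.2.2.2.2.2.2.2.2.2.2.2.2.2.2.2.2.1
  have hHn := hP.2.2.2.2.2.2.2.2.2.2.2.2.2.2.2.2.2.2.1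
  have hGS := hP.2.2.2.2.2.2.2.2.2.2.2.2.2.2.2.2.2.2.2
  have hE : WeierstrassCurve.hasEntireLFunction_rat :=
    WeierstrassCurve.hasEntireLFunction_rat_of_exists_isNewformOf hnf
  have hpP : p.Prime := Fact.out
  have hp2 : p ≠ 2 := hc.2.1.1
  have hred : ¬ W.HasIrreducibleModPGaloisRep p := hc.2.1.2.1
  have hmult : W.HasMultiplicativeReductionAtPrime p := hc.2.1.2.2
  have hr : W.analyticRank = 0 := hc.1
  obtain ⟨C, hC⟩ := hWd
  have hXd : ClassX2 Wd p := X2.classX2_twist W p hc.2.1 K hK hHp Wd ⟨C, hC⟩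
  have hnsd : ¬ Wd.HasSplitMultiplicativeReductionAtPrime p := fun hs ↦
    hns ((X2.hasSplitMultiplicativeReductionAtPrime_iff_of_smul_eq_quadraticTwist W Wd hK p hp2 hmult hHp
      hC).mp hs)
  have hUd : MissingUpperBoundAt Wd p :=
    missingUpperBoundAt_of_cellC_of_not_split_of_lamMin hP hDis Wd p ⟨hrd, hXd⟩ hnsd hμ0 hlam
  exact mazurMainConjectureAt_of_indexLowerBoundAt_of_upper_twist hWu hJs hJn hHs hHn hGZK hE W p (hGS W p) N K
    Dt H ι P (hGZ _ W K) (hKo _ W K) hK hodd hlt hN hHN hHp hPt hcM hp2 hmult hred hr Wd ⟨C, hC⟩ hrd hlow hUd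

end Summit.BirchSwinnertonDyer.BirchSwinnertonDyer.Theorems.EisensteinPrimesMazurMCOnCellBTwistbackOnePartnerCertificates

end
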